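import Summits.Ventures.HodgeRepro.BallGenSylvester
import Summits.Ventures.HodgeRepro.CongruenceGen
import Summits.Ventures.HodgeRepro.BallCongruenceNF

/-!
# The finite-index clause of Lemma W for the unitary group of any Hermitian form of signature `(p,1)` (seat p5)

Blind re-derivation cell `pub-hodge-repro`, seat `p5`.  Built on typer-2's `BallGenSylvester.lean`
(`unitaryGroupOf H_K` = the `K`-points of `U(V, h)` for a Hermitian matrix `H_K` over the CM field `K`;
`conjToU P hP ∘ embUof φ₀ H_K : unitaryGroupOf H_K →* U(p,1)` along a Sylvester matrix `P`; `ratPointsOf`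
its range — the `Δ` of Lemma W / ROUTE.md A4 for a general form), on p5's `CongruenceGen.lean` (generic
congruence subgroups, Hecke conjugation, finite index, transport) and `BallCongruenceNF.lean` (common
denominators in `𝓞_K`, finite quotients).  Mathlib otherwise.

* `arithU H_K = U(H_K)(𝓞_K)`, `congrU H_K M = Γ(M)` — the arithmetic group and its principal congruence
  subgroups inside the `K`-points `unitaryGroupOf H_K`;
* `exists_denominator_GL` — every `g ∈ GL_n(K)` has `N · g`, `N · g⁻¹` integral for some `N ∈ 𝓞_K ∖ 0`;
* **`isFiniteRelIndex_inf_conjSubG_unitaryGroupOf`** — for `Γ(M) ≤ Γ′ ≤ U(H_K)(𝓞_K)`, `M ≠ 0`, and EVERY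
  `K`-point `g`, the subgroup `Γ′ ⊓ g⁻¹ Γ′ g` has finite index in `Γ′`;
* `toUp_injective` — the passage to `U(p,1)` is injective;
* **`isFiniteRelIndex_inf_conjSubG_ratPointsOf`** — the same statement transported into `U(p,1)`: inside
  `ratPointsOf φ₀ H_K P hP ≤ U(p,1)`, the image `Γ′` of an arithmetic subgroup and every rational `g` have
  `Γ′ ⊓ g⁻¹ Γ′ g` of finite index in `Γ′` — ROUTE.md A4's «Γ″ := Γ′ ∩ g⁻¹Γ′g (congruence, finite index)» for the
  unitary group of an ARBITRARY Hermitian form of signature `(p,1)` over a CM field, every `p`.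

Nothing here says anything about the status of the Hodge conjecture for CM abelian varieties.
-/

set_option autoImplicit false

noncomputable section

namespace Summit.Ventures.HodgeRepro

namespace CongHerm

open Matrix
open NumberField
open HodgeRepro.BallGen (Idx GLp U unitaryOf unitaryGroupOf conjToU embUof ratPointsOf embGL coe_embGL)
open CongGen

variable {p : ℕ} {K : Type} [Field K] [NumberField K] [IsCMField K]

/-! ### Common denominators in `GL_n(K)` -/

/-- The integral structure `𝓞_K → K`. -/
abbrev φO (K : Type) [Field K] [NumberField K] : 𝓞 K →+* K := algebraMap (𝓞 K) K

omit [IsCMField K] in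
/-- `φO` is injective. -/
theorem φO_injective : Function.Injective (φO K) := RingOfIntegers.coe_injective

omit [IsCMField K] in
/-- **Common denominator in `GL_n(K)`.**  Every `g ∈ GL_n(K)` has `N · g` and `N · g⁻¹` integral over `𝓞_K`
for some `N ∈ 𝓞_K ∖ {0}`. -/
theorem exists_denominator_GL (g : GL (Idx p) K) :
    ∃ N : 𝓞 K, N ≠ 0 ∧ ∃ A B : Matrix (Idx p) (Idx p) (𝓞 K),
      Mφ (φO K) A = φO K N • (g : Matrix (Idx p) (Idx p) K) ∧
        Mφ (φO K) B = φO K N • ((g⁻¹ : GL (Idx p) K) : Matrix (Idx p) (Idx p) K) := by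
  obtain ⟨N, hN, r, hr⟩ := BallCong.exists_integral_multiple_of_finite K
    (Sum.elim (fun q : Idx p × Idx p => (g : Matrix (Idx p) (Idx p) K) q.1 q.2)
      fun q : Idx p × Idx p => ((g⁻¹ : GL (Idx p) K) : Matrix (Idx p) (Idx p) K) q.1 q.2)
  refine ⟨N, hN, Matrix.of fun i j => r (Sum.inl (i, j)), Matrix.of fun i j => r (Sum.inr (i, j)), ?_, ?_⟩
  · ext i j
    simp only [RingHom.mapMatrix_apply, Matrix.map_apply, Matrix.of_apply, Matrix.smul_apply,
      smul_eq_mul, hr, Sum.elim_inl]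
  · ext i j
    simp only [RingHom.mapMatrix_apply, Matrix.map_apply, Matrix.of_apply, Matrix.smul_apply,
      smul_eq_mul, hr, Sum.elim_inr]

/-! ### The arithmetic group `U(H_K)(𝓞_K)` and its congruence subgroups -/

variable (HK : Matrix (Idx p) (Idx p) K)

/-- The arithmetic subgroup `U(H_K)(𝓞_K) ≤ U(H_K)(K)`: matrix and inverse matrix over `𝓞_K`. -/
abbrev arithU : Subgroup (unitaryGroupOf HK) := arith (unitaryGroupOf HK) (φO K)

/-- The principal congruence subgroup `Γ(M) ≤ U(H_K)(K)` of level `M ∈ 𝓞_K`. -/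
abbrev congrU (M : 𝓞 K) : Subgroup (unitaryGroupOf HK) :=
  congr (unitaryGroupOf HK) (φO K) (φO_injective (K := K)) M

/-- **The finite-index clause in `U(H_K)(K)`.**  For `Γ(M) ≤ Γ′ ≤ U(H_K)(𝓞_K)`, `M ≠ 0`, and every `K`-point
`g ∈ U(H_K)(K)`, the subgroup `Γ′ ⊓ g⁻¹ Γ′ g` has finite index in `Γ′`. -/
theorem isFiniteRelIndex_inf_conjSubG_unitaryGroupOf {Γ' : Subgroup (unitaryGroupOf HK)}
    (hΓ : Γ' ≤ arithU HK) {M : 𝓞 K} (hM0 : M ≠ 0) (hM : congrU HK M ≤ Γ') (g : unitaryGroupOf HK) :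
    (Γ' ⊓ conjSubG g Γ').IsFiniteRelIndex Γ' := by
  obtain ⟨N, hN, A, B, hA, hB⟩ := exists_denominator_GL (g : GL (Idx p) K)
  haveI : Finite (𝓞 K ⧸ Ideal.span {N ^ 2 * M}) :=
    BallCong.finite_quotient_span_of_ne_zero (mul_ne_zero (pow_ne_zero 2 hN) hM0)
  exact isFiniteRelIndex_inf_conjSubG (unitaryGroupOf HK) (φO K) (φO_injective (K := K)) hΓ hM g A B hA hB

/-! ### Transport into `U(p,1)` along a Sylvester matrix -/

omit [NumberField K] [IsCMField K] in
/-- The entrywise embedding `GL_n(K) → GL_n(ℂ)` is injective. -/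
theorem embGL_injective (φ₀ : K →+* ℂ) : Function.Injective (embGL (p := p) φ₀) := by
  intro a b h
  apply Units.ext
  apply Matrix.map_injective φ₀.injective
  have := congrArg (fun x : GLp p => (x : Matrix (Idx p) (Idx p) ℂ)) h
  simpa only [coe_embGL] using this

/-- `embUof φ₀ H_K` is injective. -/
theorem embUof_injective (φ₀ : K →+* ℂ) : Function.Injective (embUof (p := p) φ₀ HK) := by
  intro a b h
  apply Subtype.ext
  apply embGL_injective φ₀
  exact congrArg (fun x : unitaryOf (HK.map φ₀) => (x : GLp p)) h

/-- `conjToU P hP` is injective. -/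
theorem conjToU_injective {H : Matrix (Idx p) (Idx p) ℂ} (P : GLp p)
    (hP : (P : Matrix (Idx p) (Idx p) ℂ)ᴴ * H * (P : Matrix (Idx p) (Idx p) ℂ) = HodgeRepro.BallGen.J p) :
    Function.Injective (conjToU (H := H) P hP) := by
  intro a b h
  apply Subtype.ext
  have := congrArg (fun x : U p => (x : GLp p)) h
  change P⁻¹ * (a : GLp p) * P = P⁻¹ * (b : GLp p) * P at this
  simpa using this

/-- The passage `U(H_K)(K) → U(p,1)`: entrywise embedding followed by conjugation into `U(p,1)`. -/
abbrev toUp (φ₀ : K →+* ℂ) (P : GLp p)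
    (hP : (P : Matrix (Idx p) (Idx p) ℂ)ᴴ * HK.map φ₀ * (P : Matrix (Idx p) (Idx p) ℂ) =
      HodgeRepro.BallGen.J p) : unitaryGroupOf HK →* U p :=
  (conjToU P hP).comp (embUof φ₀ HK)

/-- `toUp` is injective. -/
theorem toUp_injective (φ₀ : K →+* ℂ) (P : GLp p)
    (hP : (P : Matrix (Idx p) (Idx p) ℂ)ᴴ * HK.map φ₀ * (P : Matrix (Idx p) (Idx p) ℂ) =
      HodgeRepro.BallGen.J p) : Function.Injective (toUp HK φ₀ P hP) :=
  (conjToU_injective P hP).comp (embUof_injective HK φ₀)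

/-- The range of `toUp` is typer-2's `ratPointsOf`. -/
theorem range_toUp (φ₀ : K →+* ℂ) (P : GLp p)
    (hP : (P : Matrix (Idx p) (Idx p) ℂ)ᴴ * HK.map φ₀ * (P : Matrix (Idx p) (Idx p) ℂ) =
      HodgeRepro.BallGen.J p) : (toUp HK φ₀ P hP).range = ratPointsOf φ₀ HK P hP := rfl

/-- **The finite-index clause of Lemma W (ROUTE.md A4) for the rational points of an arbitrary Hermitian form of
signature `(p,1)` over a CM field, inside `U(p,1)`.**  Let `Γ(M) ≤ Γ′ ≤ U(H_K)(𝓞_K)`, `M ≠ 0`, `g ∈ U(H_K)(K)`,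
and transport everything to `U(p,1)` by `toUp` (image inside `ratPointsOf φ₀ H_K P hP`).  Then
`toUp(Γ′) ⊓ toUp(g)⁻¹ toUp(Γ′) toUp(g)` has finite index in `toUp(Γ′)`. -/
theorem isFiniteRelIndex_inf_conjSubG_ratPointsOf (φ₀ : K →+* ℂ) (P : GLp p)
    (hP : (P : Matrix (Idx p) (Idx p) ℂ)ᴴ * HK.map φ₀ * (P : Matrix (Idx p) (Idx p) ℂ) =
      HodgeRepro.BallGen.J p) {Γ' : Subgroup (unitaryGroupOf HK)} (hΓ : Γ' ≤ arithU HK) {M : 𝓞 K}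
    (hM0 : M ≠ 0) (hM : congrU HK M ≤ Γ') (g : unitaryGroupOf HK) :
    (Γ'.map (toUp HK φ₀ P hP) ⊓ conjSubG (toUp HK φ₀ P hP g) (Γ'.map (toUp HK φ₀ P hP))).IsFiniteRelIndex
      (Γ'.map (toUp HK φ₀ P hP)) :=
  isFiniteRelIndex_map_inf_conjSubG (toUp_injective HK φ₀ P hP)
    (isFiniteRelIndex_inf_conjSubG_unitaryGroupOf HK hΓ hM0 hM g)

/-- The transported arithmetic subgroups lie in `ratPointsOf`. -/
theorem map_toUp_le_ratPointsOf (φ₀ : K →+* ℂ) (P : GLp p)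
    (hP : (P : Matrix (Idx p) (Idx p) ℂ)ᴴ * HK.map φ₀ * (P : Matrix (Idx p) (Idx p) ℂ) =
      HodgeRepro.BallGen.J p) (Γ' : Subgroup (unitaryGroupOf HK)) :
    Γ'.map (toUp HK φ₀ P hP) ≤ ratPointsOf φ₀ HK P hP :=
  Subgroup.map_le_range _ _

end CongHerm

end Summit.Ventures.HodgeRepro

end
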